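import Literature.NumberTheory.EllipticCurves.ShaIsogenyProofs
import Literature.NumberTheory.EllipticCurves.ZpCorankQuasiIso
import Literature.NumberTheory.EllipticCurves.SelmerCorankHolds
import Literature.NumberTheory.EllipticCurves.IsogenyMordellWeilRankProofs
import HarnessLib

/-!
# The `ℤ_p`-coranks of `Ш(E/K)[p^∞]` and of `Sel_{p^∞}(E/K)` are isogeny invariants

Topic `NumberTheory/EllipticCurves`. For `K`-isogenous elliptic curves `E, E'` over a number
field `K` and a prime `p`,

* `WeierstrassCurve.Isogeny.shaCorank_eq`, `WeierstrassCurve.IsIsogenous.shaCorank_eq`: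
  `corank_{ℤ_p} Ш(E/K)[p^∞] = corank_{ℤ_p} Ш(E'/K)[p^∞]`;
* `WeierstrassCurve.Isogeny.selmerCorank_eq`, `WeierstrassCurve.IsIsogenous.selmerCorank_eq`:
  `corank_{ℤ_p} Sel_{p^∞}(E/K) = corank_{ℤ_p} Sel_{p^∞}(E'/K)`,

for the tree's `WeierstrassCurve.shaCorank` and `WeierstrassCurve.selmerCorank` (file `Selmer`;
Greenberg, LNM 1716 (1999), §1), **proved unconditionally**.

## The argument (Greenberg 1999, §1; Milne, *ADT*, proof of Lemma I.7.1(b))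

Let `φ : E → E'` be an isogeny over `K` of degree `n ≥ 1` and `ψ = φ̂ : E' → E` its dual,
`ψ ∘ φ = [n]` on `E(K̄)` (Silverman, *AEC*, III.6.1(a); tree: `Isogeny.exists_dual_of_isElliptic`,
proved). Since `φ` is onto `K̄`-points (`Isogeny.surjective`, *AEC* II.2.3, proved), also
`φ ∘ ψ = [n]` on `E'(K̄)`. The induced maps `Ш(φ) : Ш(E/K) → Ш(E'/K)`, `Ш(ψ)` (tree:
`Literature.NumberTheory.EllipticCurves.shaMap`, available for every isogeny by
`Isogeny.hasLocalPointsMaps_toAddMonoidHom`, `ShaIsogenyProofs`) therefore satisfy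
`Ш(ψ) ∘ Ш(φ) = n` and `Ш(φ) ∘ Ш(ψ) = n` (functoriality on continuous cocycles,
`galH1Map_galH1Map_of_comp_eq_nsmul`). Restricting to `p`-primary parts gives a homomorphism
`Ш(E/K)[p^∞] → Ш(E'/K)[p^∞]` whose kernel and cokernel are killed by `n`; both groups are
`p`-primary with finite `p`-torsion (`Ш[p]` is finite: Silverman X.4.2(b), tree
`finite_sha_torsionBy_holds`), so their coranks agree by the quasi-isomorphism invariance of the
corank (`Literature.NumberTheory.EllipticCurves.zpCorank_eq_of_nsmul_ker_of_nsmul_coker`, file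
`ZpCorankQuasiIso`; Greenberg 1999, §1). Finally
`corank Sel_{p^∞}(E/K) = rank E(K) + corank Ш(E/K)[p^∞]` (Greenberg 1999, §1, pp. 54–57; tree
`selmerCorank_eq_mordellWeilRank_add_holds`) and `rank E(K) = rank E'(K)`
(`Isogeny.mordellWeilRank_eq`), whence the Selmer statement. This is the standard fact
"the `p^∞`-Selmer corank is an isogeny invariant" (e.g. A. Smith, arXiv:2503.17619, proof of
Prop. 1.18: "since the first map … has finite kernel and `r_{2^∞}(E^d)` equals the corank of
`Sel^{2^∞} E^d`, we have `r_{2^∞}(E^d) = r_{2^∞}(E_0^d)`").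

## Design notes

* Theorems only, no new definitions or named facts: the restriction of `Ш(φ)` to the `p`-primary
  parts is built inside the proof with `AddMonoidHom.codRestrict`.
* Group-wide rules of `Selmer`/`ShaIsogeny`: `noncomputable section`, `open scoped Classical`, one
  universe `u`; dot-notation extensions in `namespace WeierstrassCurve`.

## References

* R. Greenberg, *Iwasawa theory for elliptic curves*, LNM 1716 (1999), §1, pp. 54–57.
  [Greenberg1999LNM]
* J. S. Milne, *Arithmetic Duality Theorems*, 2nd ed. (2006), Ch. I, Lemma 7.1(b) and its proof
  (p. 96). [MilneADT2006]
* J. H. Silverman, *The Arithmetic of Elliptic Curves*, 2nd ed., GTM 106 (2009), II.2.3,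
  III.6.1(a), III.6.2, X.4.2(b). [SilvermanAEC2009]
* A. Smith, *The Birch and Swinnerton-Dyer conjecture implies Goldfeld's conjecture*,
  arXiv:2503.17619 (2025), Prop. 1.18 (proof). [arXiv250317619]
-/

noncomputable section

open scoped Classical
open scoped AddSubgroup

universe u

namespace WeierstrassCurve

open Literature.NumberTheory.EllipticCurves Literature.NumberTheory.GaloisRepresentations

variable {K : Type u} [Field K] {W W' : WeierstrassCurve K}

namespace Isogeny

/-- **`φ ∘ φ̂ = [deg φ]` on `E'(K̄)`** from `φ̂ ∘ φ = [deg φ]` and the surjectivity of `φ` on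
`K̄`-points. Silverman, *AEC*, Thm. III.6.2(a) (`φ̂ ∘ φ = [m]` on `E₁`, `φ ∘ φ̂ = [m]` on `E₂`).
[cite: SilvermanAEC2009, Thm. III.6.2(a)] -/
theorem comp_dual_apply_eq_zsmul [CharZero K] [W.IsElliptic] [W'.IsElliptic] (φ : Isogeny W W')
    {ψ : Isogeny W' W} {n : ℤ} (hψ : ∀ P, ψ (φ P) = n • P) (Q : W'.geomPoints) :
    φ (ψ Q) = n • Q := by
  obtain ⟨P, rfl⟩ := φ.surjective Q
  rw [hψ P, map_zsmul]

/-- **`Ш(ψ) (Ш(φ) c) = n • c`** for isogenies `φ : E → E'`, `ψ : E' → E` with `ψ ∘ φ = [n]` on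
`K̄`-points: the identity `H¹(ψ) ∘ H¹(φ) = n` (`galH1Map_galH1Map_of_comp_eq_nsmul`) restricted
to `Ш`. Milne, *ADT*, proof of Lemma I.7.1(b) (p. 96).
[cite: MilneADT2006, Ch. I Lemma 7.1(b) (proof), p. 96] -/
theorem shaMap_shaMap_of_comp_eq_nsmul [NumberField K] (φ : Isogeny W W') (ψ : Isogeny W' W)
    {n : ℕ} (h : ∀ P, ψ (φ P) = (n : ℤ) • P) (c : W.sha) :
    shaMap ψ.toAddMonoidHom ψ.equivariant ψ.hasLocalPointsMaps_toAddMonoidHom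
        (shaMap φ.toAddMonoidHom φ.equivariant φ.hasLocalPointsMaps_toAddMonoidHom c) =
      n • c := by
  apply Subtype.ext
  rw [coe_shaMap_apply, coe_shaMap_apply, AddSubgroupClass.coe_nsmul]
  exact galH1Map_galH1Map_of_comp_eq_nsmul φ.toAddMonoidHom φ.equivariant ψ.toAddMonoidHom
    ψ.equivariant (fun P ↦ h P) (c : W.galH1)

/-- **The `ℤ_p`-corank of `Ш[p^∞]` is an isogeny invariant** (elliptic curves over a number
field): for an isogeny `φ : E → E'` over `K` and a prime `p`,
`corank_{ℤ_p} Ш(E/K)[p^∞] = corank_{ℤ_p} Ш(E'/K)[p^∞]`. With the dual isogeny `ψ`,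
`ψ ∘ φ = [n] = φ ∘ ψ` (`n = deg φ ≥ 1`), the map `Ш(E/K)[p^∞] → Ш(E'/K)[p^∞]` induced by `Ш(φ)`
has kernel and cokernel killed by `n`, and both groups are `p`-primary with finite `p`-torsion
(`Ш[p]` finite, Silverman X.4.2(b)), so the coranks agree
(`zpCorank_eq_of_nsmul_ker_of_nsmul_coker`). Greenberg, LNM 1716, §1; Milne, *ADT*, proof of
Lemma I.7.1(b). [cite: Greenberg1999LNM, §1 pp. 54–57]
[cite: MilneADT2006, Ch. I Lemma 7.1(b) (proof), p. 96] -/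
theorem shaCorank_eq [NumberField K] [W.IsElliptic] [W'.IsElliptic] (φ : Isogeny W W') (p : ℕ)
    [hp : Fact p.Prime] :
    W.shaCorank p = W'.shaCorank p := by
  -- the dual isogeny and the two composition identities
  obtain ⟨ψ, hψ⟩ := φ.exists_dual_of_isElliptic
  set n : ℕ := φ.degree with hn_def
  have hn : n ≠ 0 := φ.degree_pos.ne'
  have hφψ : ∀ Q, φ (ψ Q) = (n : ℤ) • Q := fun Q ↦ φ.comp_dual_apply_eq_zsmul hψ Q
  -- `Ш(φ)`, `Ш(ψ)` and `Ш(ψ) ∘ Ш(φ) = n`, `Ш(φ) ∘ Ш(ψ) = n`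
  set f : W.sha →+ W'.sha :=
    shaMap φ.toAddMonoidHom φ.equivariant φ.hasLocalPointsMaps_toAddMonoidHom with hf_def
  set g : W'.sha →+ W.sha :=
    shaMap ψ.toAddMonoidHom ψ.equivariant ψ.hasLocalPointsMaps_toAddMonoidHom with hg_def
  have hgf : ∀ c, g (f c) = n • c := fun c ↦ φ.shaMap_shaMap_of_comp_eq_nsmul ψ hψ c
  have hfg : ∀ c', f (g c') = n • c' := fun c' ↦ ψ.shaMap_shaMap_of_comp_eq_nsmul φ hφψ c'
  -- the `p`-primary parts and the restriction of `Ш(φ)`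
  set A : AddSubgroup W.sha := AddCommGroup.primaryComponent W.sha p with hA_def
  set B : AddSubgroup W'.sha := AddCommGroup.primaryComponent W'.sha p with hB_def
  have hfmem : ∀ a : A, f a ∈ B := fun a ↦ by
    obtain ⟨k, hk⟩ := (AddCommGroup.mem_primaryComponent).mp a.2
    exact (AddCommGroup.mem_primaryComponent).mpr ⟨k, by rw [← map_nsmul, hk, map_zero]⟩
  have hgmem : ∀ b : B, g b ∈ A := fun b ↦ by
    obtain ⟨k, hk⟩ := (AddCommGroup.mem_primaryComponent).mp b.2
    exact (AddCommGroup.mem_primaryComponent).mpr ⟨k, by rw [← map_nsmul, hk, map_zero]⟩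
  let F : A →+ B := (f.comp A.subtype).codRestrict B fun a ↦ hfmem a
  have hF : ∀ a : A, ((F a : B) : W'.sha) = f a := fun _ ↦ rfl
  -- both are `p`-primary with finite `p`-torsion (`Ш[p]` is finite)
  have hAprim : ∀ a : A, ∃ k : ℕ, p ^ k • a = 0 := fun a ↦ by
    obtain ⟨k, hk⟩ := (AddCommGroup.mem_primaryComponent).mp a.2
    exact ⟨k, Subtype.ext (by rw [AddSubgroupClass.coe_nsmul, hk, ZeroMemClass.coe_zero])⟩
  have hBprim : ∀ b : B, ∃ k : ℕ, p ^ k • b = 0 := fun b ↦ by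
    obtain ⟨k, hk⟩ := (AddCommGroup.mem_primaryComponent).mp b.2
    exact ⟨k, Subtype.ext (by rw [AddSubgroupClass.coe_nsmul, hk, ZeroMemClass.coe_zero])⟩
  have hp0 : ((p : ℕ) : ℤ) ≠ 0 := by exact_mod_cast hp.out.ne_zero
  haveI : Finite (AddSubgroup.torsionBy W.sha (p : ℤ)) :=
    W.finite_sha_torsionBy_holds (p : ℤ) hp0
  haveI : Finite (AddSubgroup.torsionBy W'.sha (p : ℤ)) :=
    W'.finite_sha_torsionBy_holds (p : ℤ) hp0
  haveI : Finite A[(p : ℤ)] := by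
    refine Finite.of_injective
      (fun x : A[(p : ℤ)] ↦ (⟨((x : A) : W.sha), AddSubgroup.torsionBy.nsmul_iff.mpr ?_⟩ :
        AddSubgroup.torsionBy W.sha (p : ℤ))) ?_
    · rw [← AddSubgroupClass.coe_nsmul, ← AddSubgroupClass.coe_nsmul,
        AddSubgroup.torsionBy.nsmul x, ZeroMemClass.coe_zero, ZeroMemClass.coe_zero]
    · intro x y hxy
      exact Subtype.ext (Subtype.ext (congrArg
        (fun z : AddSubgroup.torsionBy W.sha (p : ℤ) ↦ (z : W.sha)) hxy))
  haveI : Finite B[(p : ℤ)] := by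
    refine Finite.of_injective
      (fun x : B[(p : ℤ)] ↦ (⟨((x : B) : W'.sha), AddSubgroup.torsionBy.nsmul_iff.mpr ?_⟩ :
        AddSubgroup.torsionBy W'.sha (p : ℤ))) ?_
    · rw [← AddSubgroupClass.coe_nsmul, ← AddSubgroupClass.coe_nsmul,
        AddSubgroup.torsionBy.nsmul x, ZeroMemClass.coe_zero, ZeroMemClass.coe_zero]
    · intro x y hxy
      exact Subtype.ext (Subtype.ext (congrArg
        (fun z : AddSubgroup.torsionBy W'.sha (p : ℤ) ↦ (z : W'.sha)) hxy))
  -- kernel and cokernel of `F` are killed by `n`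
  have hker : ∀ a : A, F a = 0 → n • a = 0 := fun a ha ↦ by
    have ha' : f a = 0 := by rw [← hF a, ha]; rfl
    apply Subtype.ext
    rw [AddSubgroupClass.coe_nsmul, ZeroMemClass.coe_zero, ← hgf, ha', map_zero]
  have hcoker : ∀ b : B, n • b ∈ F.range := fun b ↦
    ⟨⟨g b, hgmem b⟩, Subtype.ext (by rw [hF, AddSubgroupClass.coe_nsmul]; exact hfg b)⟩
  -- quasi-isomorphism invariance of the corank
  have key := zpCorank_eq_of_nsmul_ker_of_nsmul_coker F hAprim hBprim hn hker hcoker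
  simpa only [shaCorank] using key

/-- **The `ℤ_p`-corank of the `p^∞`-Selmer group is an isogeny invariant** (elliptic curves
over a number field): for an isogeny `φ : E → E'` over `K` and a prime `p`,
`corank_{ℤ_p} Sel_{p^∞}(E/K) = corank_{ℤ_p} Sel_{p^∞}(E'/K)`. From
`corank Sel_{p^∞} = rank E(K) + corank Ш[p^∞]` (Greenberg, LNM 1716, §1, pp. 54–57; tree
`selmerCorank_eq_mordellWeilRank_add_holds`), the isogeny invariance of the Mordell–Weil rank
(`Isogeny.mordellWeilRank_eq`) and of `corank Ш[p^∞]` (`Isogeny.shaCorank_eq`).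
[cite: Greenberg1999LNM, §1 pp. 54–57] [cite: MilneADT2006, Ch. I Lemma 7.1(b) (proof), p. 96] -/
theorem selmerCorank_eq [NumberField K] [W.IsElliptic] [W'.IsElliptic] (φ : Isogeny W W') (p : ℕ)
    [Fact p.Prime] :
    W.selmerCorank p = W'.selmerCorank p := by
  have h₁ : W.selmerCorank p = W.mordellWeilRank + W.shaCorank p :=
    W.selmerCorank_eq_mordellWeilRank_add_holds p
  have h₂ : W'.selmerCorank p = W'.mordellWeilRank + W'.shaCorank p :=
    W'.selmerCorank_eq_mordellWeilRank_add_holds p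
  rw [h₁, h₂, φ.mordellWeilRank_eq, φ.shaCorank_eq p]

end Isogeny

/-- **Isogenous elliptic curves over a number field have the same `corank_{ℤ_p} Ш[p^∞]`.**
Greenberg, LNM 1716, §1; Milne, *ADT*, proof of Lemma I.7.1(b).
[cite: Greenberg1999LNM, §1 pp. 54–57] [cite: MilneADT2006, Ch. I Lemma 7.1(b) (proof), p. 96] -/
theorem IsIsogenous.shaCorank_eq [NumberField K] [W.IsElliptic] [W'.IsElliptic]
    (h : IsIsogenous W W') (p : ℕ) [Fact p.Prime] : W.shaCorank p = W'.shaCorank p :=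
  h.elim fun φ ↦ φ.shaCorank_eq p

/-- **Isogenous elliptic curves over a number field have the same `p^∞`-Selmer corank**:
`E ∼_K E'` implies `corank_{ℤ_p} Sel_{p^∞}(E/K) = corank_{ℤ_p} Sel_{p^∞}(E'/K)` for every
prime `p`. Greenberg, LNM 1716, §1 (pp. 54–57); the form used by A. Smith, arXiv:2503.17619,
proof of Prop. 1.18. [cite: Greenberg1999LNM, §1 pp. 54–57] -/
theorem IsIsogenous.selmerCorank_eq [NumberField K] [W.IsElliptic] [W'.IsElliptic]
    (h : IsIsogenous W W') (p : ℕ) [Fact p.Prime] : W.selmerCorank p = W'.selmerCorank p :=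
  h.elim fun φ ↦ φ.selmerCorank_eq p

end WeierstrassCurve

end
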